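import Literature.AlgebraicGeometry.Resolution.EmbeddedResolutionExcellentSurfacesHistory
import Literature.AlgebraicGeometry.Resolution.RegularRestrictionLocal
import Literature.AlgebraicGeometry.Resolution.HypersurfaceRestriction
import Literature.AlgebraicGeometry.Resolution.HypersurfaceCentres
import Literature.AlgebraicGeometry.Resolution.RegularBlowup
import Literature.AlgebraicGeometry.Resolution.KollarTripleBlowup
import Literature.AlgebraicGeometry.Resolution.CartierDivisorControlledTransform
import Literature.AlgebraicGeometry.Resolution.HilbertSamuelIsolatedSingularities
import Literature.AlgebraicGeometry.Resolution.RegularSubschemeLocallyIrreducible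
import Literature.AlgebraicGeometry.Resolution.EmbeddedResolutionExcellentSurfaces
import Literature.AlgebraicGeometry.Resolution.NonPrincipalLocus
import Literature.Topology.KrullDimensionDrop
import HarnessLib

/-!
# Chain W5.2 — F6 stage 1, residual `LegalDivisorReduction₃`, PHASE 2: TOOLS for discharging the OURS binder
# `OldBoundaryResolution₃` from the Cossart–Jannsen–Saito history construction-fact (F-72ν)

[OURS · L1 W5.2 · res-D-pv-016 AS res-L1-w52-stub-5, (K-b) `oldBoundaryResolution₃_of_F72ν` (res-L1-w52-plan-1 CHAIN v2.5 l.422, R-F72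
13:09:25Z/13:10:07Z; res-L1-w52-idea-1 O3.3 13:11:04Z).]  NOT statements of the manuscript under review; AI-written, weaker than expert
review; fact-free (no named fact is consumed here — the F-72ν binder enters only in the sibling `…OfF72`).

The (K-b) inference «on a REGULAR hypersurface the Hilbert–Samuel function is constant, so the history `O` is never reset and every
centre of a `ν̃`-elimination lies on the strict transform of the INITIAL boundary» needs, along the CJS sequence:
* §1 **regular-hypersurface host transport** (`regularHost_controlledTransform`): for `D` an effective Cartier divisor with `V(D)`
  regular and a regular centre `C ≥ D`, the weight-one transform `τᶜ(D, 1)` is an effective Cartier divisor with `V(τᶜ(D,1))`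
  REGULAR (tree restriction property `IsBlowup.isBlowup_subscheme_controlledTransform_of_isRegular`: it is the blowing up of `V(D)`
  along `C|_{V(D)}`; `IsBlowup.isRegular_of_isRegular_subscheme`) and support EXACTLY the strict transform set
  `closure (τ⁻¹(Supp D ∖ V(C)))` (the exceptional divisor restricts to an effective Cartier divisor of `V(τᶜ(D,1))`, whose
  complement is dense — `IsEffectiveCartier.dense_compl_support`);
* §2 **`H_X ≡ ν_reg` on a regular closed set of dimension `≤ 2`** (`hsFunOn_eq_iterPSum_of_isRegular`): res-lit-6's
  `CJSHistory.hsFunOn Z X 2 z = iterPSum 2 Phi` for `z ∈ X` (the `dite`/`choose` of `hsFunOn` unpacked; tree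
  `Scheme.hsFun_of_mem_regularLocus` + `exists_ringKrullDim_stalk_eq_of_topologicalKrullDim_le`), with the dimension bound for the
  support of a Cartier divisor on an integral threefold (`topologicalKrullDim_support_le_two`);
* §3 **boundary bookkeeping** for `CJSHistory.boundaryTransform` (Def. 4.4 (b)): the union over ALL labels is the complete transform
  `τ⁻¹(⋃B ∪ D)`, the union over the OLD labels `< k` is the strict transform `closure (τ⁻¹(⋃_{j<k} B_j ∖ D))`;
* §4 **history bookkeeping** (`histTransform_eq_old_of_eq`): in the near case ((4.6), `H'' x' = H' (τ x')`) the history stays «the old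
  labels through the point»;
* §5 the **lexicographic step**: in a value set with constant first coordinate and two distinct values, every maximal element has
  second coordinate `≥ 1`.

[cite: CossartJannsenSaito2020, Def. 4.4 (b), (4.6), Def. 6.23 (1), Rem. 6.24, Lemma 2.31/Rem. 2.32]
[cite: BierstoneGrigorievMilmanWlodarczyk2011, §4 Remark (3)] [cite: GortzWedhorn2020, Remark 9.24]
-/

-- `Summit.<Summit>.<Sub>.Theorems` with `Sub = Summit` (single-conjunct summit, D-0017)
set_option linter.dupNamespace false

noncomputable section

open CategoryTheory CategoryTheory.Limits AlgebraicGeometry TopologicalSpace IsLocalRing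
open Literature.AlgebraicGeometry.Resolution Literature.RingTheory.HilbertSamuel
open Scheme.IdealSheafData

namespace Summit.ResolutionOfSingularities.ResolutionOfSingularities.Theorems.DepthLegal

universe u

variable {W W' : Scheme.{u}}

/-! ## §1 Regular-hypersurface host transport under one blowing up -/

/-- **The weight-one transform of a regular hypersurface through a regular centre is a regular hypersurface** (restriction
property: it is the blowing up of `V(D)` along `C|_{V(D)}`): for `W` regular locally Noetherian, `D` an effective Cartier divisor
with `V(D)` regular, `C ≥ D` with `V(C)` regular and `τ` the blowing up along `C`, `τᶜ(D, 1)` is an effective Cartier divisor and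
`V(τᶜ(D, 1))` is regular. [cite: BierstoneGrigorievMilmanWlodarczyk2011, §4 Remark (3)] [cite: Liu2002, Thm. 8.1.19 (a)] -/
theorem regularHost_controlledTransform [IsLocallyNoetherian W] (hW : Scheme.IsRegular W) {D C : W.IdealSheafData}
    (hD : IsEffectiveCartier D) (hDreg : Scheme.IsRegular D.subscheme) (hC : Scheme.IsRegular C.subscheme) (hDC : D ≤ C)
    {τ : W' ⟶ W} (hτ : IsBlowup τ C) :
    IsEffectiveCartier (controlledTransform τ C D 1) ∧ Scheme.IsRegular (controlledTransform τ C D 1).subscheme := by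
  refine ⟨hτ.isEffectiveCartier_controlledTransform_of_le_pow hD (by simpa using hDC), ?_⟩
  obtain ⟨πS, hπS⟩ := exists_hom_subscheme_controlledTransform τ C D
  have hbl := hτ.isBlowup_subscheme_controlledTransform_of_isRegular hW hC hDC hDreg πS hπS
  haveI : IsLocallyNoetherian D.subscheme := LocallyOfFiniteType.isLocallyNoetherian D.subschemeι
  exact IsBlowup.isRegular_of_isRegular_subscheme hDreg ((isRegular_subscheme_comap_subschemeι_iff D hDC).mpr hC) hbl

/-- **Support of the weight-one transform of a regular hypersurface = the strict transform SET** `closure (τ⁻¹(Supp D ∖ V(C)))`: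
`⊇` is `IsBlowup.closure_preimage_diff_subset_support_controlledTransform`; `⊆` because the exceptional divisor restricts to an
effective Cartier divisor of the regular scheme `V(τᶜ(D,1))` (`isEffectiveCartier_comap_subschemeι_controlledTransform_of_isRegular`),
whose complement — lying over `Supp D ∖ V(C)` — is dense (`IsEffectiveCartier.dense_compl_support`).
[cite: BierstoneGrigorievMilmanWlodarczyk2011, §4 Remark (3)] [cite: GortzWedhorn2020, Remark 9.24] -/
theorem support_controlledTransform_eq_closure_of_isRegular [IsLocallyNoetherian W] (hW : Scheme.IsRegular W)
    {D C : W.IdealSheafData} (hDreg : Scheme.IsRegular D.subscheme) (hC : Scheme.IsRegular C.subscheme)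
    (hDC : D ≤ C) {τ : W' ⟶ W} (hτ : IsBlowup τ C) :
    ((controlledTransform τ C D 1).support : Set W') = closure (τ ⁻¹' ((D.support : Set W) \ C.support)) := by
  haveI : IsLocallyNoetherian W' := hτ.isLocallyNoetherian
  refine le_antisymm ?_ (hτ.closure_preimage_diff_subset_support_controlledTransform 1)
  set K := controlledTransform τ C D 1 with hK
  haveI : IsLocallyNoetherian K.subscheme := LocallyOfFiniteType.isLocallyNoetherian K.subschemeι
  have hE : IsEffectiveCartier ((C.comap τ).comap K.subschemeι) :=
    hτ.isEffectiveCartier_comap_subschemeι_controlledTransform_of_isRegular hW hC hDC hDreg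
  have hdense := hE.dense_compl_support
  intro x' hx'
  -- `x'` is the image of a point of `V(K)`, which lies in the closure of the complement of the exceptional divisor
  obtain ⟨v, rfl⟩ : x' ∈ Set.range K.subschemeι := by rw [Scheme.IdealSheafData.range_subschemeι]; exact hx'
  have hv : v ∈ closure ((((C.comap τ).comap K.subschemeι).support : Set K.subscheme)ᶜ) := by
    rw [hdense.closure_eq]; exact Set.mem_univ v
  have himg := (map_mem_closure K.subschemeι.continuous hv (t := τ ⁻¹' ((D.support : Set W) \ C.support)) ?_)
  · exact himg
  · intro u hu
    refine ⟨?_, ?_⟩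
    · -- over `Supp D`: `Supp K ⊆ Supp τ^*D = τ⁻¹ Supp D`
      have h1 : K.subschemeι u ∈ (K.support : Set W') := by
        rw [← Scheme.IdealSheafData.range_subschemeι]; exact Set.mem_range_self u
      have h2 : K.subschemeι u ∈ ((D.comap τ).support : Set W') :=
        Scheme.IdealSheafData.support_antitone (comap_le_controlledTransform τ C D 1) h1
      rw [Scheme.IdealSheafData.support_comap] at h2
      exact h2
    · -- off the exceptional divisor
      intro hC'
      apply hu
      show u ∈ (((C.comap τ).comap K.subschemeι).support : Set K.subscheme)
      rw [Scheme.IdealSheafData.support_comap]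
      show K.subschemeι u ∈ ((C.comap τ).support : Set W')
      rw [Scheme.IdealSheafData.support_comap]
      exact hC'

/-! ## §2 The Hilbert–Samuel function on a regular closed set of dimension `≤ 2` -/

/-- **`H_X ≡ ν_reg` on a regular closed set of dimension at most two**: for `X ⊆ Z` closed with the reduced closed subscheme on
`X` regular and `dim X ≤ 2`, res-lit-6's `CJSHistory.hsFunOn Z X 2 z = iterPSum 2 Phi` (`= Φ^{(2)}`) at every `z ∈ X`.
[cite: CossartJannsenSaito2020, Lemma 2.31, Rem. 2.32, Def. 2.28 (3)] -/
theorem hsFunOn_eq_iterPSum_of_isRegular {Z : Scheme.{u}} [IsLocallyNoetherian Z] {X : Set Z} (hXc : IsClosed X)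
    (hreg : Scheme.IsRegular (vanishingIdeal ⟨closure X, isClosed_closure⟩).subscheme)
    (hdim : topologicalKrullDim X ≤ 2) {z : Z} (hz : z ∈ X) :
    CJSHistory.hsFunOn Z X 2 z = iterPSum 2 Phi := by
  set I := vanishingIdeal (⟨closure X, isClosed_closure⟩ : Closeds Z) with hI
  have hex : ∃ t : ↥(I.subscheme), I.subschemeι t = z := by
    have : z ∈ Set.range I.subschemeι := by
      rw [Scheme.IdealSheafData.range_subschemeι, hI, Scheme.IdealSheafData.coe_support_vanishingIdeal]
      exact subset_closure hz
    exact this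
  rw [CJSHistory.hsFunOn, dif_pos hex]
  haveI : IsLocallyNoetherian I.subscheme := LocallyOfFiniteType.isLocallyNoetherian I.subschemeι
  -- the chosen point is a regular point of a scheme of dimension `≤ 2`
  have hdim' : topologicalKrullDim ↥(I.subscheme) ≤ 2 := by
    rw [hI, topologicalKrullDim_subscheme_vanishingIdeal]
    change topologicalKrullDim (closure X) ≤ 2
    rwa [hXc.closure_eq]
  obtain ⟨d, hd, hd2⟩ := exists_ringKrullDim_stalk_eq_of_topologicalKrullDim_le hdim' hex.choose
  exact Scheme.hsFun_of_mem_regularLocus (hreg hex.choose) hd hd2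

/-- **The support of an effective Cartier divisor on an integral threefold has dimension `≤ 2`** (a proper closed subset — the
generic point is not on it — of an irreducible space of dimension `3`). [folklore] -/
theorem topologicalKrullDim_support_le_two {Z : Scheme.{u}} [IsIntegral Z] (hdim : topologicalKrullDim Z = 3)
    {D : Z.IdealSheafData} (hD : IsEffectiveCartier D) : topologicalKrullDim (D.support : Set Z) ≤ 2 := by
  have hne : (D.support : Set Z) ≠ Set.univ := fun h =>
    DeJong1996.NormalProjectivePair.genericPoint_notMem_support hD (h ▸ Set.mem_univ _)
  have hlt := Literature.Topology.topologicalKrullDim_lt_of_isClosed_ssubset D.support.isClosed hne (2 + 1)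
    (by rw [hdim]; exact_mod_cast (by norm_num : (3 : ℕ) < 2 + 1 + 1))
  rw [Nat.cast_add_one] at hlt
  exact_mod_cast (ENat.WithBot.lt_add_one_iff.mp hlt)

/-! ## §3 Boundary bookkeeping for `CJSHistory.boundaryTransform` -/

/-- **The union of all members of the transformed boundary is the complete transform** `τ⁻¹(⋃_i B_i ∪ D)` (labels `≥ k` being
empty before the step). [cite: CossartJannsenSaito2020, Def. 4.4 (b)] -/
theorem iUnion_boundaryTransform {Z Z' : Scheme.{u}} (τ : Z' ⟶ Z) {B : ℕ → Set Z} {k : ℕ} (hB : ∀ i, k ≤ i → B i = ∅)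
    (hBc : IsClosed (⋃ i, B i)) {D : Set Z} (hD : IsClosed D) :
    (⋃ i, CJSHistory.boundaryTransform τ B k D i) = τ ⁻¹' ((⋃ i, B i) ∪ D) := by
  apply le_antisymm
  · refine Set.iUnion_subset fun i => ?_
    rcases lt_trichotomy i k with hi | rfl | hi
    · rw [CJSHistory.boundaryTransform_of_lt τ B k D hi]
      refine closure_minimal ?_ ((hBc.union hD).preimage τ.continuous)
      exact (Set.preimage_mono Set.sdiff_subset).trans
        (Set.preimage_mono (Set.subset_union_of_subset_left (Set.subset_iUnion B i) D))
    · rw [CJSHistory.boundaryTransform_self]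
      exact Set.preimage_mono Set.subset_union_right
    · rw [CJSHistory.boundaryTransform_of_gt τ B k D hi]; exact Set.empty_subset _
  · intro x' hx'
    rcases hx' with hx' | hx'
    · obtain ⟨i, hi⟩ := Set.mem_iUnion.mp hx'
      have hik : i < k := by
        by_contra h
        rw [hB i (not_lt.mp h)] at hi
        exact hi
      by_cases hxD : τ x' ∈ D
      · exact Set.mem_iUnion.mpr ⟨k, by rw [CJSHistory.boundaryTransform_self]; exact hxD⟩
      · exact Set.mem_iUnion.mpr ⟨i, by
          rw [CJSHistory.boundaryTransform_of_lt τ B k D hik]; exact subset_closure ⟨hi, hxD⟩⟩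
    · exact Set.mem_iUnion.mpr ⟨k, by rw [CJSHistory.boundaryTransform_self]; exact hx'⟩

/-- **The union of the OLD-label members (labels `< k ≤ k'`) of the transformed boundary is the strict transform**
`closure (τ⁻¹(⋃_{j<k} B_j ∖ D))` of the union of the old members (finite unions commute with closure).
[cite: CossartJannsenSaito2020, Def. 4.4 (b)] -/
theorem biUnion_lt_boundaryTransform {Z Z' : Scheme.{u}} (τ : Z' ⟶ Z) (B : ℕ → Set Z) {k k' : ℕ} (hkk : k ≤ k')
    (D : Set Z) :
    (⋃ i ∈ Set.Iio k, CJSHistory.boundaryTransform τ B k' D i) = closure (τ ⁻¹' ((⋃ i ∈ Set.Iio k, B i) \ D)) := by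
  have hfin : (Set.Iio k).Finite := Set.finite_Iio k
  have h1 : (⋃ i ∈ Set.Iio k, CJSHistory.boundaryTransform τ B k' D i) =
      ⋃ i ∈ Set.Iio k, closure (τ ⁻¹' (B i \ D)) := by
    refine Set.iUnion₂_congr fun i hi => ?_
    exact CJSHistory.boundaryTransform_of_lt τ B k' D (lt_of_lt_of_le (Set.mem_Iio.mp hi) hkk)
  rw [h1, ← hfin.closure_biUnion]
  congr 1
  ext x'
  simp only [Set.mem_iUnion, Set.mem_preimage, Set.mem_sdiff, exists_prop]
  constructor
  · rintro ⟨i, hi, hB, hD⟩; exact ⟨⟨i, hi, hB⟩, hD⟩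
  · rintro ⟨⟨i, hi, hB⟩, hD⟩; exact ⟨i, hi, hB, hD⟩

/-! ## §4 History bookkeeping in the near case -/

/-- **The history stays «the old labels through the point» in the near case**: if `O'(τ x') = {j < k | τ x' ∈ B'_j}` and
`H''(x') = H'(τ x')`, then the transformed history ((4.6), `CJSHistory.histTransform`) at `x'` is `{j < k | x' ∈ B''_j}` for the
transformed boundary `B'' = boundaryTransform τ B' k' D` (`k ≤ k'`, old members closed: an old-label transform
`closure (τ⁻¹(B'_j ∖ D))` lies over `B'_j`). [cite: CossartJannsenSaito2020, (4.6), Def. 4.4 (b)] -/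
theorem histTransform_eq_old {Z Z' : Scheme.{u}} (τ : Z' ⟶ Z) (H' : Z → (ℕ → ℕ)) (H'' : Z' → (ℕ → ℕ))
    {B' : ℕ → Set Z} {k k' : ℕ} (hkk : k ≤ k') (hBc : ∀ j < k, IsClosed (B' j)) (D : Set Z) {O' : Z → Set ℕ}
    {x' : Z'} (hO : O' (τ x') = Set.Iio k ∩ BoundaryHistory.boundaryAt B' (τ x')) (hH : H'' x' = H' (τ x')) :
    CJSHistory.histTransform τ H' H'' (CJSHistory.boundaryTransform τ B' k' D) O' x' =
      Set.Iio k ∩ BoundaryHistory.boundaryAt (CJSHistory.boundaryTransform τ B' k' D) x' := by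
  rw [CJSHistory.histTransform_of_eq τ H' H'' _ O' hH, hO]
  ext j
  simp only [Set.mem_inter_iff, Set.mem_Iio, BoundaryHistory.boundaryAt, Set.mem_setOf_eq]
  constructor
  · rintro ⟨⟨hj, -⟩, hx'⟩; exact ⟨hj, hx'⟩
  · rintro ⟨hj, hx'⟩
    refine ⟨⟨hj, ?_⟩, hx'⟩
    -- `x' ∈ B''_j = closure (τ⁻¹(B'_j ∖ D)) ⊆ τ⁻¹ B'_j`
    rw [CJSHistory.boundaryTransform_of_lt τ B' k' D (lt_of_lt_of_le hj hkk)] at hx'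
    exact closure_minimal ((Set.preimage_mono Set.sdiff_subset)) ((hBc j hj).preimage τ.continuous) hx'

/-! ## §5 The lexicographic step -/

/-- **Maximal elements of a value set with constant first coordinate and two distinct values have second coordinate `≥ 1`**
(`H ≡ ν_reg` on a regular host; a component that is not `O`-equisingular has two distinct `|O|`-values).
[cite: CossartJannsenSaito2020, Rem. 6.22 (c), Def. 6.23 (1)] -/
theorem one_le_snd_of_maximal {α : Type*} [PartialOrder α] {S : Set (α ×ₗ ℕ)} {c : α}
    (hS : ∀ w ∈ S, (ofLex w).1 = c) {w₁ w₂ : α ×ₗ ℕ} (h₁ : w₁ ∈ S) (h₂ : w₂ ∈ S) (hne : w₁ ≠ w₂)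
    {v : α ×ₗ ℕ} (hv : Maximal (· ∈ S) v) : 1 ≤ (ofLex v).2 := by
  have hvS : v ∈ S := hv.1
  -- every value in `S` has second coordinate `≤` that of `v`
  have key : ∀ w ∈ S, (ofLex w).2 ≤ (ofLex v).2 := by
    intro w hw
    by_contra hlt
    rw [not_le] at hlt
    have hvw : v ≤ w := by
      rw [← toLex_ofLex v, ← toLex_ofLex w, Prod.Lex.toLex_le_toLex]
      exact Or.inr ⟨by rw [hS v hvS, hS w hw], hlt.le⟩
    have hwv : w ≤ v := hv.2 hw hvw
    rw [← toLex_ofLex v, ← toLex_ofLex w, Prod.Lex.toLex_le_toLex] at hwv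
    rcases hwv with h | ⟨-, h⟩
    · rw [hS v hvS, hS w hw] at h; exact lt_irrefl _ h
    · exact absurd h (not_le.mpr hlt)
  -- the two distinct values have distinct second coordinates, one of which is `≥ 1`
  have hsnd : (ofLex w₁).2 ≠ (ofLex w₂).2 := by
    intro h
    apply hne
    rw [← toLex_ofLex w₁, ← toLex_ofLex w₂]
    congr 1
    exact Prod.ext (by rw [hS w₁ h₁, hS w₂ h₂]) h
  rcases Nat.eq_zero_or_pos (ofLex w₁).2 with h0 | hpos
  · have : 0 < (ofLex w₂).2 := by omega
    exact le_trans this (key w₂ h₂)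
  · exact le_trans hpos (key w₁ h₁)

end Summit.ResolutionOfSingularities.ResolutionOfSingularities.Theorems.DepthLegal

end
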